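import Mathlib
import HarnessLib
import Summits.ValiantsHypothesis.ValiantsHypothesis.Theses.MonotoneRestoration
import Summits.ValiantsHypothesis.ValiantsHypothesis.Theorems.MonotoneRestorationOrbitRestorationQPValueOrbitDivision
import Summits.ValiantsHypothesis.ValiantsHypothesis.Theorems.MonotoneRestorationMonotoneRestorationQPLinearWidthDefs
import Summits.ValiantsHypothesis.ValiantsHypothesis.Theorems.MonotoneRestorationQP.Negative.OrbitRestorationFalseOfPolylogWidthVP
import Literature.Computability.AlgebraicComplexity.VPClosedUnderSum

/-!
# Route MonotoneRestoration, crux `OrbitRestorationQP` (stmt-18293) — THE BOOLEAN CIRCUIT HALF `W₁` IS THE WHOLE CRUX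
# (helper, def-free)

The lossless cut `SimpleGraphCut.orbitRestorationQP_iff_cut_witness` (p825944) reads `L1 ⟺ W₁ ∧ ¬ PolylogWidthVP` with the
"circuit half"

  `W₁`: every matrix-symmetric `VP` family whose values at `0/1` ADJACENCY MATRICES OF SIMPLE GRAPHS are eventually
        `C^{(log₂ m + c)^c}`-determined has square-symmetric circuits of quasi-polynomial orbit size,

advertised (SIMPLE-GRAPH-CUT-g3, exit reports of hands −2 g3 / −4 g1) as `VH`-free surplus next to the finite-model-theory
half `H₁ = ¬ PolylogWidthVP`.  THIS FILE SHOWS THAT `W₁` ALONE IS EQUIVALENT TO THE CRUX (`orbitRestorationQP_iff_booleanW`),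
hence implies `H₁` (`not_polylogWidthVP_of_booleanW`) and `VH`: the Boolean determinedness hypothesis can be bought for free.

Mechanism (`orbitRestorationQP_of_booleanW`).  Let `E_n = Π_{j ≤ n²} (U_n − j)`, `U_n = Σ_{pq} x_{pq}`.  `E_n` is invariant
under independent row and column permutations, lies in `VP` (degree `n² + 1`, complexity `≤ n⁶ + 6`), VANISHES AT EVERY
`0/1` POINT (there `U_n ∈ {0, …, n²}`), is orbit-restorable with constant `5` (`Restorable.qpOrbitRestorable_aeval_U`, a
polynomial in `U`), and does NOT vanish at the `Sym_n`-fixed base point `a ≡ 2` (`U_n(a) = 2n² > n²`, `n ≥ 1`).  For any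
matrix-symmetric `VP` family `h`, the family `E·h` is matrix-symmetric, `VP`, and TRIVIALLY determined on simple graphs
(constant `0`), so `W₁` restores `E·h`; exact division at the invariant base point
(`ValueOrbitDivision.qpOrbitRestorable_of_mul_eq_of_eval_ne_zero`, Strassen in orbit currency, p-landed for 18293) restores
`h` (level `+ 38`; `n = 0` by `Restorable.qpOrbitRestorable_of_invariant`).  So `W₁ → OrbitRestorationQP`.

Consequences recorded: `orbitRestorationQP_iff_booleanW` (`L1 ⟺ W₁`), `not_polylogWidthVP_of_booleanW` (`W₁ → ¬ PolylogWidthVP`,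
through the landed `stub_orbitRestoration_false_of_polylogWidthVP`).  Reading for the steward: a width-to-orbit statement
is a genuine (possibly `VH`-free) circuit half only if its determinedness hypothesis constrains the family OFF the Boolean
points — e.g. the weighted `WidthRestorationQP` of line `linear_width` (hypothesis `PolylogHomDetermined` at all complex
points), for which no such multiplier exists (`…LinearWidthMultiplierNoGo.lean`); the Boolean `W₁` / `Wᵐ ∧ …` re-gluings
proposed in SIMPLE-GRAPH-CUT-g3 are NOT leaner than the crux.  Honest label: a collapse of a proposed cut, by glue over
landed theorems; no stub closed; VP ≠ VNP untouched. [folklore; cite: Strassen1973]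
-/

-- `Summit.ValiantsHypothesis.ValiantsHypothesis.…` is the tree's mandated namespace (Sub = Summit).
set_option linter.dupNamespace false

noncomputable section

open scoped Classical

namespace Summit.ValiantsHypothesis.ValiantsHypothesis.Theorems

namespace BooleanWidthCollapse

open MvPolynomial Finset
open Summit.ValiantsHypothesis.ValiantsHypothesis.Theses.MonotoneRestoration
open Literature.Computability.AlgebraicComplexity
open Literature.ModelTheory.FiniteModelTheory
open MonotoneRestorationQPLinearWidth OrbitRestorationQPDepthThreeRung LevelStructure

variable {n : ℕ}

/-! ### The multiplier `E_n = Π_{j ≤ n²} (U_n − j)` -/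

/-- `E_n` is the value at `U_n` of the one-variable polynomial `Π_{j ≤ n²} (X − j)`. [folklore] -/
theorem aeval_U_prod (n : ℕ) :
    Polynomial.aeval (U n) (∏ j ∈ range (n * n + 1), (Polynomial.X - Polynomial.C (j : ℂ))) =
      ∏ j ∈ range (n * n + 1), (U n - C (j : ℂ)) := by
  rw [map_prod]
  refine prod_congr rfl fun j _ => ?_
  rw [map_sub, Polynomial.aeval_X, Polynomial.aeval_C, algebraMap_eq]

/-- `E_n` is orbit-restorable with constant `5` (a polynomial in the invariant form `U_n`). [folklore] -/
theorem qpOrbitRestorable_E (n : ℕ) : QPOrbitRestorable 5 n (∏ j ∈ range (n * n + 1), (U n - C (j : ℂ))) := by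
  rw [← aeval_U_prod]
  exact Restorable.qpOrbitRestorable_aeval_U _

/-- `E_n` is invariant under independent row and column permutations. [folklore] -/
theorem rename_E (n : ℕ) (σ τ : Equiv.Perm (Fin n)) :
    rename (fun p : Fin n × Fin n => (σ p.1, τ p.2)) (∏ j ∈ range (n * n + 1), (U n - C (j : ℂ))) =
      ∏ j ∈ range (n * n + 1), (U n - C (j : ℂ)) := by
  rw [map_prod]
  refine prod_congr rfl fun j _ => ?_
  rw [map_sub, rename_C, ← mact_apply, mact_U]

/-- The value of `U_n` at a `0/1` point is the number of ones, a natural number `≤ n²`. [folklore] -/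
theorem eval_indicator_U (S : Set (Fin n × Fin n)) :
    ∃ N : ℕ, N ≤ n * n ∧ eval (Set.indicator S (1 : Fin n × Fin n → ℂ)) (U n) = (N : ℂ) := by
  refine ⟨(univ.filter fun P : Fin n × Fin n => P ∈ S).card, ?_, ?_⟩
  · calc (univ.filter fun P : Fin n × Fin n => P ∈ S).card ≤ (univ : Finset (Fin n × Fin n)).card :=
          card_filter_le _ _
      _ = n * n := by rw [card_univ, Fintype.card_prod, Fintype.card_fin]
  · rw [U, map_sum, natCast_card_filter]
    refine sum_congr rfl fun P _ => ?_
    rw [eval_X, Set.indicator_apply]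
    rfl

/-- **`E_n` vanishes at every `0/1` point.** [folklore] -/
theorem eval_indicator_E (S : Set (Fin n × Fin n)) :
    eval (Set.indicator S (1 : Fin n × Fin n → ℂ)) (∏ j ∈ range (n * n + 1), (U n - C (j : ℂ))) = 0 := by
  obtain ⟨N, hN, hU⟩ := eval_indicator_U S
  rw [map_prod]
  refine prod_eq_zero (mem_range.2 (Nat.lt_succ_of_le hN)) ?_
  rw [map_sub, hU, eval_C, sub_self]

/-- **`E_n` does not vanish at the invariant base point `a ≡ 2`** (`n ≥ 1`): `U_n(a) = 2n²` exceeds every `j ≤ n²`.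
[folklore] -/
theorem eval_two_E_ne_zero (hn : 1 ≤ n) :
    eval (fun _ : Fin n × Fin n => (2 : ℂ)) (∏ j ∈ range (n * n + 1), (U n - C (j : ℂ))) ≠ 0 := by
  rw [map_prod]
  refine prod_ne_zero_iff.2 fun j hj => ?_
  have hU : eval (fun _ : Fin n × Fin n => (2 : ℂ)) (U n) = ((2 * (n * n) : ℕ) : ℂ) := by
    rw [U, map_sum]
    simp only [eval_X, sum_const, card_univ, Fintype.card_prod, Fintype.card_fin, nsmul_eq_mul]
    push_cast
    ring
  rw [map_sub, hU, eval_C, sub_ne_zero, Nat.cast_inj.ne]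
  have hj' := mem_range.1 hj
  have h1 : 1 ≤ n * n := Nat.mul_pos hn hn
  omega

/-- The total degree of `U_n` is at most `1`. [folklore] -/
theorem totalDegree_U_le (n : ℕ) : (U n).totalDegree ≤ 1 :=
  (totalDegree_finsetSum _ _).trans (Finset.sup_le fun P _ => (totalDegree_X (R := ℂ) P).le)

/-- Each factor `U_n − j` has total degree `≤ 1`. [folklore] -/
theorem totalDegree_U_sub_C_le (n : ℕ) (j : ℕ) : (U n - C (j : ℂ)).totalDegree ≤ 1 := by
  refine (totalDegree_sub _ _).trans (max_le (totalDegree_U_le n) ?_)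
  have h : (C (j : ℂ) : MvPolynomial (Fin n × Fin n) ℂ).totalDegree = 0 := totalDegree_C (j : ℂ)
  omega

/-- `deg E_n ≤ n² + 1`. [folklore] -/
theorem totalDegree_E_le (n : ℕ) :
    (∏ j ∈ range (n * n + 1), (U n - C (j : ℂ))).totalDegree ≤ n * n + 1 := by
  have h1 : (∏ j ∈ range (n * n + 1), (U n - C (j : ℂ))).totalDegree ≤
      ∑ j ∈ range (n * n + 1), (U n - C (j : ℂ)).totalDegree :=
    totalDegree_finsetProd (range (n * n + 1)) (fun j => U n - C (j : ℂ))
  have h2 : ∑ j ∈ range (n * n + 1), (U n - C (j : ℂ)).totalDegree ≤ ∑ j ∈ range (n * n + 1), (1 : ℕ) :=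
    sum_le_sum fun j _ => totalDegree_U_sub_C_le n j
  have h3 : ∑ j ∈ range (n * n + 1), (1 : ℕ) = n * n + 1 := by
    rw [sum_const, card_range, smul_eq_mul, mul_one]
  omega

/-- `complexity U_n ≤ n²`. [folklore] -/
theorem complexity_U_le (n : ℕ) : complexity (U n) ≤ n * n := by
  refine (complexity_finset_sum_le _ _).trans ?_
  have h0 : ∀ P : Fin n × Fin n, complexity (X P : MvPolynomial (Fin n × Fin n) ℂ) = 0 :=
    fun P => complexity_X_holds P
  simp only [h0, sum_const_zero, zero_add, card_univ, Fintype.card_prod, Fintype.card_fin, le_refl]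

/-- `complexity E_n ≤ (n² + 1)·(n² + 2)`. [folklore] -/
theorem complexity_E_le (n : ℕ) :
    complexity (∏ j ∈ range (n * n + 1), (U n - C (j : ℂ))) ≤ (n * n + 1) * (n * n + 2) := by
  refine (complexity_finset_prod_le _ _).trans ?_
  have hU := complexity_U_le n
  have hj : ∀ j ∈ range (n * n + 1), complexity (U n - C (j : ℂ)) ≤ n * n + 1 := by
    intro j _
    rw [sub_eq_add_neg, ← map_neg]
    have h := complexity_add_le_holds (U n) (C (-(j : ℂ)) : MvPolynomial (Fin n × Fin n) ℂ)
    rw [complexity_C_holds] at h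
    omega
  calc ∑ j ∈ range (n * n + 1), complexity (U n - C (j : ℂ)) + (range (n * n + 1)).card
      ≤ ∑ _j ∈ range (n * n + 1), (n * n + 1) + (range (n * n + 1)).card :=
        Nat.add_le_add_right (sum_le_sum hj) _
    _ = (n * n + 1) * (n * n + 2) := by rw [sum_const, card_range, smul_eq_mul]; ring

/-- Polynomial bookkeeping: `(n²+1)(n²+2) ≤ n⁶ + 6`. [folklore] -/
theorem poly_bound (n : ℕ) : (n * n + 1) * (n * n + 2) ≤ n ^ 6 + 6 := by
  rcases Nat.lt_or_ge n 2 with h | h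
  · interval_cases n <;> norm_num
  · have h4 : 4 ≤ n * n := by nlinarith
    have : (n * n + 1) * (n * n + 2) ≤ n * n * (n * n) * (n * n) := by nlinarith
    calc (n * n + 1) * (n * n + 2) ≤ n * n * (n * n) * (n * n) := this
      _ = n ^ 6 := by ring
      _ ≤ n ^ 6 + 6 := Nat.le_add_right _ _

/-- **`E` is a `VP` family.** [folklore] -/
theorem isVPFamily_E : IsVPFamily (fun n => ∏ j ∈ range (n * n + 1), (U n - C (j : ℂ))) := by
  refine ⟨⟨⟨2, fun n => ?_⟩, ⟨6, fun n => ?_⟩⟩, ⟨6, fun n => ?_⟩⟩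
  · simp only [Fintype.card_prod, Fintype.card_fin]
    nlinarith
  · exact (totalDegree_E_le n).trans (by nlinarith [poly_bound n])
  · exact (complexity_E_le n).trans (poly_bound n)

/-! ### The collapse -/

/-- **`W₁ → OrbitRestorationQP`.**  The Boolean width-to-orbit half of the simple-graph cut implies the crux (and is
therefore equivalent to it): multiply by `E`, which kills the Boolean hypothesis, restore, and divide at the invariant base
point `a ≡ 2`. [cite: Strassen1973] -/
theorem orbitRestorationQP_of_booleanW
    (hW : ∀ f : (n : ℕ) → MvPolynomial (Fin n × Fin n) ℂ, IsMatrixSymmetric f → IsVPFamily f →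
      (∃ c N : ℕ, ∀ m : ℕ, N ≤ m → ∀ X Y : SimpleGraph (Fin m),
        CkEquiv ((Nat.log 2 m + c) ^ c) X Y →
          MvPolynomial.eval (Set.indicator {ij : Fin m × Fin m | X.Adj ij.1 ij.2} 1) (f m) =
            MvPolynomial.eval (Set.indicator {ij : Fin m × Fin m | Y.Adj ij.1 ij.2} 1) (f m)) →
      QPOrbitSymm f) :
    OrbitRestorationQP := by
  intro f hsymm hVP
  -- the family `F = E · f`
  set F : (n : ℕ) → MvPolynomial (Fin n × Fin n) ℂ :=
    fun n => (∏ j ∈ range (n * n + 1), (U n - C (j : ℂ))) * f n with hF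
  have hFsymm : IsMatrixSymmetric F := by
    intro n σ τ
    simp only [hF, map_mul, rename_E, hsymm n σ τ]
  have hFVP : IsVPFamily F := isVPFamily_E.mul hVP
  have hFdet : ∃ c N : ℕ, ∀ m : ℕ, N ≤ m → ∀ X Y : SimpleGraph (Fin m),
      CkEquiv ((Nat.log 2 m + c) ^ c) X Y →
        MvPolynomial.eval (Set.indicator {ij : Fin m × Fin m | X.Adj ij.1 ij.2} 1) (F m) =
          MvPolynomial.eval (Set.indicator {ij : Fin m × Fin m | Y.Adj ij.1 ij.2} 1) (F m) := by
    refine ⟨0, 0, fun m _ X Y _ => ?_⟩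
    simp only [hF, map_mul, eval_indicator_E, zero_mul]
  obtain ⟨c, hc⟩ := hW F hFsymm hFVP hFdet
  have hc' : ∀ n, QPOrbitRestorable c n (F n) := fun n => hc n
  -- divide by `E` at the invariant base point `a ≡ 2` (level `n ≥ 1`); `n = 0` is trivial
  refine ⟨max c 5 + 38, fun n => ?_⟩
  have key : QPOrbitRestorable (max c 5 + 38) n (f n) := by
    rcases Nat.eq_zero_or_pos n with hn | hn
    · subst hn
      have hinv : ∀ σ : Equiv.Perm (Fin 0), ren σ (f 0) = f 0 := fun σ => by
        rw [ValueOrbit.ren_eq_of_matrixSymmetric (hsymm 0)]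
      exact Restorable.qpOrbitRestorable_mono (by simp) (Restorable.qpOrbitRestorable_of_invariant (f 0) hinv)
    · exact ValueOrbitDivision.qpOrbitRestorable_of_mul_eq_of_eval_ne_zero (F := F n)
        (D := ∏ j ∈ range (n * n + 1), (U n - C (j : ℂ))) (h := f n) rfl (fun _ => (2 : ℂ))
        (fun _ _ => rfl) (eval_two_E_ne_zero hn)
        (Restorable.qpOrbitRestorable_mono (le_max_left _ _) (hc' n))
        (Restorable.qpOrbitRestorable_mono ((show 5 ≤ max c 5 from le_max_right _ _)) (qpOrbitRestorable_E n))
  exact key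

/-- **`L1 ⟺ W₁`** — the Boolean circuit half of the simple-graph cut is the whole crux. [folklore] -/
theorem orbitRestorationQP_iff_booleanW :
    OrbitRestorationQP ↔
      ∀ f : (n : ℕ) → MvPolynomial (Fin n × Fin n) ℂ, IsMatrixSymmetric f → IsVPFamily f →
        (∃ c N : ℕ, ∀ m : ℕ, N ≤ m → ∀ X Y : SimpleGraph (Fin m),
          CkEquiv ((Nat.log 2 m + c) ^ c) X Y →
            MvPolynomial.eval (Set.indicator {ij : Fin m × Fin m | X.Adj ij.1 ij.2} 1) (f m) =
              MvPolynomial.eval (Set.indicator {ij : Fin m × Fin m | Y.Adj ij.1 ij.2} 1) (f m)) →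
        QPOrbitSymm f :=
  ⟨fun hL1 f hs hVP _ => hL1 f hs hVP, orbitRestorationQP_of_booleanW⟩

/-- **`W₁ → ¬ PolylogWidthVP`**: the Boolean circuit half already excludes every polylog-width matrix-symmetric `VP`
family (it implies the crux, and the crux kills such families by the landed orbit-form support theorem). [folklore] -/
theorem not_polylogWidthVP_of_booleanW
    (hW : ∀ f : (n : ℕ) → MvPolynomial (Fin n × Fin n) ℂ, IsMatrixSymmetric f → IsVPFamily f →
      (∃ c N : ℕ, ∀ m : ℕ, N ≤ m → ∀ X Y : SimpleGraph (Fin m),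
        CkEquiv ((Nat.log 2 m + c) ^ c) X Y →
          MvPolynomial.eval (Set.indicator {ij : Fin m × Fin m | X.Adj ij.1 ij.2} 1) (f m) =
            MvPolynomial.eval (Set.indicator {ij : Fin m × Fin m | Y.Adj ij.1 ij.2} 1) (f m)) →
      QPOrbitSymm f) :
    ¬ PolylogWidthVP := fun hH =>
  stub_orbitRestoration_false_of_polylogWidthVP hH (orbitRestorationQP_of_booleanW hW)

end BooleanWidthCollapse

end Summit.ValiantsHypothesis.ValiantsHypothesis.Theorems

end
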